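import Summits.ABC.StewartYu.PadicG3Par
import HarnessLib

/-!
# The `p`-adic Gen-3 parameter record — part A: the level schedule and the END data

Support file (plain theorems). Continues `PadicG3Par`: Nesterenko's dyadic schedule
`T_s = 8L/2^s`, `X_s = 4XL/(T_s+1)`, `Mord s ν` (decrement law), `1 ≤ T_s` down to the END depth
`Ŝ`, and the END data `D j`, `κ_E`, `D₀ ≥ 9M/16` in the letters of `ZeroEnd.zeroEnd(_exitC)`.
(K-M3.1 page HOME/p1/K-M3-1-padic-ledger.md §1, §4 (B5)/(B6).)

## References
* [Nesterenko2003] Yu. V. Nesterenko, *Linear forms in logarithms of rational numbers*, LNM 1819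
  (2003) 53–106 — (4.3)–(4.5), (5.6)–(5.8), Lemma 5.3.
-/

noncomputable section

open Finset Real

namespace Summit.ABC.StewartYu

namespace PadicG3Par

variable {n : ℕ} (P : PadicG3Par n)
/-! ### The schedule `T_s`, `X_s`, `Mord` -/

/-- `T_0 = 8 L`. [cite: Nesterenko2003, (4.3)] -/
theorem T_zero : P.T 0 = 8 * P.L := by simp [T]

/-- `T_{s+1} ≤ T_s` (indeed it halves). [cite: Nesterenko2003, (4.3)] -/
theorem T_succ_le (s : ℕ) : P.T (s + 1) ≤ P.T s := by
  unfold T; exact Nat.div_le_div_left (Nat.pow_le_pow_right (by norm_num) (by omega)) (by positivity)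

/-- `2^s · T_s ≤ 8 L`. [cite: Nesterenko2003, (4.3)] -/
theorem two_pow_mul_T_le (s : ℕ) : 2 ^ s * P.T s ≤ 8 * P.L := by
  unfold T; rw [mul_comm]; exact Nat.div_mul_le_self _ _

/-- `8 L < 2^s (T_s + 1)` (the floor loses less than one unit). [folklore] -/
theorem lt_two_pow_mul_T_succ (s : ℕ) : 8 * P.L < 2 ^ s * (P.T s + 1) := by
  unfold T
  have h := Nat.lt_div_mul_add (a := 8 * P.L) (Nat.two_pow_pos s)
  rw [Nat.mul_add, Nat.mul_one, Nat.mul_comm (2 ^ s)]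
  exact h

/-- **`1 ≤ T_s` for every level `s ≤ Ŝ + 2`** (multiplicity never runs out before the END).
[cite: Nesterenko2003, §4] -/
theorem one_le_T (s : ℕ) (hs : s ≤ P.Sdepth + 2) : 1 ≤ P.T s := by
  unfold T
  rw [Nat.one_le_div_iff (by positivity)]
  have h := P.two_mul_two_pow_Sdepth_le_L
  calc 2 ^ s ≤ 2 ^ (P.Sdepth + 2) := Nat.pow_le_pow_right (by norm_num) hs
    _ = 4 * 2 ^ P.Sdepth := by ring
    _ ≤ 8 * P.L := by omega

/-- the decrement law `Mord s ν − Mord s (ν+1) = T_s` for `ν ≤ 2n+1`. [cite: Nesterenko2003, (4.5)] -/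
theorem Mord_sub_succ (s ν : ℕ) (hν : ν + 1 ≤ 2 * (n + 1)) :
    P.Mord s ν = P.Mord s (ν + 1) + P.T s := by
  unfold Mord
  have : 2 * (n + 1) - ν = (2 * (n + 1) - (ν + 1)) + 1 := by omega
  rw [this]; ring

/-- `M/(n+2)³ ≤ Mord s ν` (the order floor kept for the zero estimate). [cite: Nesterenko2003, (4.5)] -/
theorem M_div_le_Mord (s ν : ℕ) : P.M / (n + 2) ^ 3 ≤ P.Mord s ν := by
  unfold Mord; exact Nat.le_add_right _ _

/-! ### The END data -/

/-- `1 ≤ D j`. [folklore] -/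
theorem one_le_D (j : Fin n) : 1 ≤ P.D j := by unfold D; omega

/-- `N_q L/(2^{Ŝ} A j) < D j` (the floor plus one). [folklore] -/
theorem lt_D (j : Fin n) : (P.Nq : ℝ) * P.L / (2 ^ P.Sdepth * P.A j) < P.D j := by
  unfold D; push_cast; exact Nat.lt_floor_add_one _

/-- **exit-C scale: `1 ≤ κ_E · A j · D j`**, i.e. `L/Aⱼ ≤ 2^{n+24} Dⱼ` — the hypothesis of
`ZeroEnd.zeroEnd_exitC`. [cite: Nesterenko2003, §5.2] -/
theorem one_le_κE_mul (j : Fin n) : 1 ≤ P.κE * P.A j * P.D j := by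
  unfold κE
  have hA := P.A_pos j
  have hL : (0 : ℝ) < P.L := by linarith [P.one_le_L]
  have hD := P.lt_D j
  have hS : (2 : ℝ) ^ P.Sdepth ≤ 2 ^ (n + 24) * P.Nq := by exact_mod_cast P.two_pow_Sdepth_le
  have hNq : (1 : ℝ) ≤ P.Nq := by exact_mod_cast P.hNq
  -- from `hD`: `Nq · L < D j · 2^Ŝ · A j ≤ D j · 2^{n+24} Nq · A j`, hence `L ≤ 2^{n+24} A j D j`.
  have h1 : (P.Nq : ℝ) * P.L < P.D j * (2 ^ P.Sdepth * P.A j) := by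
    rwa [div_lt_iff₀ (by positivity)] at hD
  have h2 : (P.Nq : ℝ) * P.L ≤ P.Nq * (2 ^ (n + 24) * P.A j * P.D j) := by
    have : (P.D j : ℝ) * (2 ^ P.Sdepth * P.A j) ≤ P.D j * (2 ^ (n + 24) * P.Nq * P.A j) := by
      have hDpos : (0 : ℝ) ≤ P.D j := by positivity
      gcongr
    nlinarith
  have h3 : (P.L : ℝ) ≤ 2 ^ (n + 24) * P.A j * P.D j := le_of_mul_le_mul_left h2 (by linarith)
  rw [div_mul_eq_mul_div, div_mul_eq_mul_div, le_div_iff₀ hL]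
  linarith

/-- **exit hypothesis `D₀ ≥ 9M/16`**, i.e. `9 (n+1) L ≤ L₀` (from the second term of `X`).
[cite: Nesterenko2003, Lemma 5.3] -/
theorem nine_mul_le_L₀ : (9 : ℝ) * (n + 1) * P.L ≤ P.L₀ := by
  unfold L₀
  refine le_trans ?_ (Nat.le_ceil _)
  have hX : (3 / 2 : ℝ) * (n + 1) * P.L / (Cb ^ n * P.Ω * P.K) ≤ P.X := by
    have : (⌈(3 / 2 : ℝ) * (n + 1) * P.L / (Cb ^ n * P.Ω * P.K)⌉₊ : ℝ) ≤ P.X := by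
      unfold X; exact_mod_cast le_max_right _ _
    exact (Nat.le_ceil _).trans this
  have hpos : 0 < Cb ^ n * P.Ω * P.K := by
    have := P.Ω_pos; have := P.K_pos
    have : (0 : ℝ) < Cb := by unfold Cb cM; positivity
    positivity
  rw [div_le_iff₀ hpos] at hX
  nlinarith

/-- `9 M ≤ 16 D₀` (the same in the fact's letters). [cite: Nesterenko2003, Lemma 5.3] -/
theorem nine_M_le : (9 : ℝ) * P.M ≤ 16 * P.D₀ := by
  have h := P.nine_mul_le_L₀
  unfold D₀; rw [P.M_eq]; push_cast
  nlinarith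

end PadicG3Par

end Summit.ABC.StewartYu
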